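import Summits.Ventures.HSemireg.WedgeHankelRecurrenceGaussZerosAffine

/-!
# Venture HSemireg — **THE EXTREME ZEROS ARE MONOTONE IN THE OFF-DIAGONAL RECURRENCE COEFFICIENTS (PERRON–FROBENIUS FOR JACOBI MATRICES)**: for two positive recurrences with the same
# `a` and `b_j ≤ b'_j` (`1 ≤ j ≤ t`), the LARGEST zero of `q_{t+1}` does not exceed that of `q'_{t+1}` and the SMALLEST zero of `q'_{t+1}` does not exceed that of `q_{t+1}` (the zeros spread
# out as the couplings grow) — by the positive Christoffel–Darboux vector at the top zero, a square-root rescaling of coordinates, and the reflection `a ↦ −a`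

HONEST FRAMING. Part of the Lean index of the computation cell `pub-hsemireg` (seat p10 gen 44, Sunday typer «UNIFORM-IN-n»).  Real polynomials, finite sums and `Real.sqrt` only; no variety, no
cohomology theory, no sheaf, no Ext group and no semiregularity map is constructed here; nothing here says that HC / HC_CM / HC_AV holds; no Literature fact (unproved `Prop`) is declared or used.
Custodian versions as in `WedgeHankelSiegelIdeal` (1/3).
SOURCES (cited).  O. Perron, *Zur Theorie der Matrices*, Math. Ann. 64 (1907) 248–263, and G. Frobenius (1912) (the spectral radius of a non-negative irreducible matrix is monotone in its entries);
M. E. H. Ismail, *Classical and Quantum Orthogonal Polynomials* (2005) Thm 7.4.1 ∕ §7.4 (the largest zero increases with the off-diagonal recurrence coefficients; Ismail–Muldoon 1991);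
R. A. Horn, C. R. Johnson, *Matrix Analysis* (2nd ed.) Cor. 8.1.19 ∕ Thm 8.4.5.
PROOF TYPED HERE (no Perron–Frobenius theory).  With the Favard weights at the zeros (N323) the quotient `Σ μ x P² ∕ Σ μ P²`, `P = Σ v_i q_i`, is at most the top zero `x_t` (N301) and EQUALS it at
the Christoffel–Darboux vector `v*_j = (b_{j+1}⋯b_t)·q_j(x_t)`, all of whose entries are POSITIVE (N322) and whose polynomial vanishes at the other zeros (N280 `recurrence_cd_offdiag_eq_zero`);
in coordinates `Σ μ P² = Σ h_i v_i²`, `Σ μ x P² = Σ a_i h_i v_i² + Σ_{|i−j|=1} h_{max} v_i v_j` (N323 `favard_x_pairing`); the rescaling `u_i = v*_i √(h_i∕h'_i)` keeps `Σ h' u² = Σ h v*²` and the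
diagonal, and multiplies each (positive) cross term by `√(b'_j∕b_j) ≥ 1`; so `x_t Σ h v*² ≤ Σ μ' x' P'_u² ≤ x'_t Σ h v*²`.  The bottom zero is the top zero of the reflected recurrence `(−a, b)` (N324).
DEDUP DISCLOSURE (`rg -n 'offdiag|perron|extreme_zero|top_zero' Summits/Ventures/HSemireg`, 2026-09-03): N301 `gaussNode_extreme_mono` is monotonicity in the DEGREE, N323 in the diagonal; the
dependence on `b` is new.  The 7 names below: 0 hits tree-wide.

WHAT IS IN THE TREE.  N280 `recurrence_cd_offdiag_eq_zero`; N301 `sum_mul_node_mul_sq_le_last`; N322 `recurrence_eval_pos_at_top_zero`; N323 `favard_pairing_at_zeros`, `favard_norm_sq_combination`,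
`favard_x_pairing`, `weighted_sq_combination_expand`; N324 `recurrence_scale_spec`, `strictMono_neg_comp_rev`.
THIS FILE (namespace `Summit.Ventures.HSemireg.Wedge.HankelOuter` continued; CHAINED on N324 (import); 0 definitions):
* §1090 `prod_Ico_one_succ_succ` (`b_1⋯b_{n+1} = (b_1⋯b_n) b_{n+1}`), `sqrt_rescale_sq` (`h'·(√(h∕h'))² = h`), **`sqrt_rescale_cross_ge`** (`h_{i+1} ≤ h'_{i+1} √(h_i∕h'_i) √(h_{i+1}∕h'_{i+1})` when
  `b_{i+1} ≤ b'_{i+1}`), **`cd_vector_eval_eq_zero`** (the Christoffel–Darboux vector's polynomial vanishes at the other zeros), `recurrence_reflect_spec` (`(−1)^n q_n(−X)` solves `(−a, b)` with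
  zeros `−x_{t−k}`), **`top_zero_mono_offdiag`** (`b ≤ b'` on `1..t` ⇒ `x_t ≤ x'_t`), **`bottom_zero_anti_offdiag`** (`⇒ x'_0 ≤ x_0`).
CAVEATS.  Positive recurrences sharing `a`; only the EXTREME zeros are monotone in `b` (interior zeros are not, in general).  Nothing Ext-side.  New names only.
-/

open Module Polynomial
open scoped Matrix Polynomial

namespace Summit.Ventures.HSemireg.Wedge.HankelOuter

/-! ## §1090. Monotonicity of the extreme zeros in the off-diagonal coefficients -/

/-- `b_1⋯b_{n+1} = (b_1⋯b_n)·b_{n+1}`. [bookkeeping; this file, §1090] -/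
theorem prod_Ico_one_succ_succ (b : ℕ → ℝ) (n : ℕ) : ∏ l ∈ Finset.Ico 1 (n + 1 + 1), b l = (∏ l ∈ Finset.Ico 1 (n + 1), b l) * b (n + 1) :=
  Finset.prod_Ico_succ_top (show 1 ≤ n + 1 by omega) b

/-- `h'·(√(h∕h'))² = h` for `h ≥ 0`, `h' > 0`. [bookkeeping; this file, §1090] -/
theorem sqrt_rescale_sq {h h' : ℝ} (hh : 0 ≤ h) (hh' : 0 < h') : h' * Real.sqrt (h / h') ^ 2 = h := by
  rw [Real.sq_sqrt (div_nonneg hh hh'.le), mul_div_cancel₀ _ hh'.ne']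

/-- **The cross terms grow: `h_{i+1} ≤ h'_{i+1}·√(h_i∕h'_i)·√(h_{i+1}∕h'_{i+1})` when `b_{i+1} ≤ b'_{i+1}`** (`h_n = b_1⋯b_n`, `h'_n = b'_1⋯b'_n`, all positive; the right side is `h_i √(b_{i+1} b'_{i+1})`).
[this file, §1090] -/
theorem sqrt_rescale_cross_ge {b b' : ℕ → ℝ} (hb : ∀ j, 0 < b j) (hb' : ∀ j, 0 < b' j) {i : ℕ} (hle : b (i + 1) ≤ b' (i + 1)) :
    ∏ l ∈ Finset.Ico 1 (i + 1 + 1), b l ≤ (∏ l ∈ Finset.Ico 1 (i + 1 + 1), b' l) *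
      (Real.sqrt ((∏ l ∈ Finset.Ico 1 (i + 1), b l) / ∏ l ∈ Finset.Ico 1 (i + 1), b' l) * Real.sqrt ((∏ l ∈ Finset.Ico 1 (i + 1 + 1), b l) / ∏ l ∈ Finset.Ico 1 (i + 1 + 1), b' l)) := by
  rw [prod_Ico_one_succ_succ b i, prod_Ico_one_succ_succ b' i]
  obtain ⟨A, hA⟩ : ∃ A : ℝ, A = ∏ l ∈ Finset.Ico 1 (i + 1), b l := ⟨_, rfl⟩
  obtain ⟨A', hA'⟩ : ∃ A' : ℝ, A' = ∏ l ∈ Finset.Ico 1 (i + 1), b' l := ⟨_, rfl⟩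
  have hApos : 0 < A := by rw [hA]; exact Finset.prod_pos fun l _ => hb l
  have hA'pos : 0 < A' := by rw [hA']; exact Finset.prod_pos fun l _ => hb' l
  rw [← hA, ← hA']
  have hβ := hb (i + 1)
  have hβ' := hb' (i + 1)
  have hX : A / A' * (A * b (i + 1) / (A' * b' (i + 1))) = A ^ 2 * (b (i + 1) * b' (i + 1)) / (A' * b' (i + 1)) ^ 2 := by
    field_simp
  have hsq : A' * b' (i + 1) * (Real.sqrt (A / A') * Real.sqrt (A * b (i + 1) / (A' * b' (i + 1)))) = Real.sqrt (A ^ 2 * (b (i + 1) * b' (i + 1))) := by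
    rw [← Real.sqrt_mul (div_nonneg hApos.le hA'pos.le), hX, Real.sqrt_div (by positivity), Real.sqrt_sq (by positivity)]
    field_simp
  rw [hsq, show A * b (i + 1) = Real.sqrt ((A * b (i + 1)) ^ 2) from (Real.sqrt_sq (mul_pos hApos hβ).le).symm]
  refine Real.sqrt_le_sqrt ?_
  rw [show (A * b (i + 1)) ^ 2 = A ^ 2 * (b (i + 1) * b (i + 1)) by ring]
  exact mul_le_mul_of_nonneg_left (mul_le_mul_of_nonneg_left hle hβ.le) (sq_nonneg _)

/-- **THE CHRISTOFFEL–DARBOUX VECTOR AT A ZERO**: for `q_{t+1} = ∏ (X − x_k)` and a zero `x_{k₀}`, the polynomial `Σ_j (b_{j+1}⋯b_t) q_j(x_{k₀})·q_j` vanishes at every other zero `x_k`.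
[N280 `recurrence_cd_offdiag_eq_zero` repackaged; this file, §1090] -/
theorem cd_vector_eval_eq_zero {q : ℕ → ℝ[X]} {a b : ℕ → ℝ} (hq0 : q 0 = 1) (hq1 : q 1 = Polynomial.X - C (a 0))
    (hrec : ∀ n, q (n + 2) = (Polynomial.X - C (a (n + 1))) * q (n + 1) - C (b (n + 1)) * q n)
    {t : ℕ} {x : Fin (t + 1) → ℝ} (hx : StrictMono x) (hxq : q (t + 1) = ∏ k, (Polynomial.X - C (x k))) {k₀ k : Fin (t + 1)} (hk : k ≠ k₀) :
    (∑ j : Fin (t + 1), C ((∏ l ∈ Finset.Ico ((j : ℕ) + 1) (t + 1), b l) * (q j).eval (x k₀)) * q j).eval (x k) = 0 := by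
  have hxr : ∀ j, (q (t + 1)).eval (x j) = 0 := fun j => by
    rw [hxq, eval_prod]; exact Finset.prod_eq_zero (Finset.mem_univ j) (by rw [eval_sub, eval_X, eval_C, sub_self])
  have h := recurrence_cd_offdiag_eq_zero hq0 hq1 hrec t (hx.injective.ne (Ne.symm hk)) (hxr k₀) (hxr k)
  rw [Finset.sum_range (fun j => (∏ l ∈ Finset.Ico (j + 1) (t + 1), b l) * ((q j).eval (x k₀) * (q j).eval (x k)))] at h
  rw [eval_finsetSum, ← h]
  exact Finset.sum_congr rfl fun j _ => by rw [eval_mul, eval_C]; ring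

/-- **The reflected recurrence**: `Q_n = (−1)^n q_n(−X)` (written `C((−1)^n)·q_n ∘ ((−1)⁻¹X)`) solves `(−a, b)`, and `Q_{t+1} = ∏_k (X − (−x_{t−k}))`. [N324 `recurrence_scale_spec` at `c = −1`;
this file, §1090] -/
theorem recurrence_reflect_spec {q : ℕ → ℝ[X]} {a b : ℕ → ℝ} (hq0 : q 0 = 1) (hq1 : q 1 = Polynomial.X - C (a 0))
    (hrec : ∀ n, q (n + 2) = (Polynomial.X - C (a (n + 1))) * q (n + 1) - C (b (n + 1)) * q n) :
    C ((-1 : ℝ) ^ 0) * (q 0).comp (C (-1 : ℝ)⁻¹ * Polynomial.X) = 1 ∧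
      C ((-1 : ℝ) ^ 1) * (q 1).comp (C (-1 : ℝ)⁻¹ * Polynomial.X) = Polynomial.X - C (-a 0) ∧
      (∀ n, C ((-1 : ℝ) ^ (n + 2)) * (q (n + 2)).comp (C (-1 : ℝ)⁻¹ * Polynomial.X) =
        (Polynomial.X - C (-a (n + 1))) * (C ((-1 : ℝ) ^ (n + 1)) * (q (n + 1)).comp (C (-1 : ℝ)⁻¹ * Polynomial.X)) -
          C (b (n + 1)) * (C ((-1 : ℝ) ^ n) * (q n).comp (C (-1 : ℝ)⁻¹ * Polynomial.X))) ∧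
      ∀ {t : ℕ} {x : Fin (t + 1) → ℝ}, q (t + 1) = ∏ k, (Polynomial.X - C (x k)) →
        C ((-1 : ℝ) ^ (t + 1)) * (q (t + 1)).comp (C (-1 : ℝ)⁻¹ * Polynomial.X) = ∏ k : Fin (t + 1), (Polynomial.X - C (-x (Fin.rev k))) := by
  obtain ⟨h0, h1, h2, h3⟩ := recurrence_scale_spec hq0 hq1 hrec (show (-1 : ℝ) ≠ 0 by norm_num)
  refine ⟨h0, by rw [h1, neg_one_mul], fun n => by rw [h2 n, neg_one_mul]; norm_num, fun {t x} hxq => ?_⟩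
  rw [h3 hxq]
  exact Fintype.prod_equiv Fin.revPerm _ _ fun k => by simp [Fin.revPerm_apply, Fin.rev_rev]

/-- **THE LARGEST ZERO IS NON-DECREASING IN THE OFF-DIAGONAL COEFFICIENTS: same `a`, `0 < b_j ≤ b'_j` for `1 ≤ j ≤ t` ⇒ `x_t ≤ x'_t`** (largest zeros of `q_{t+1}`, `q'_{t+1}`).
[Perron 1907; Ismail Thm 7.4.1; Horn–Johnson Cor. 8.1.19; this file, §1090] -/
theorem top_zero_mono_offdiag {q q' : ℕ → ℝ[X]} {a b b' : ℕ → ℝ} (hq0 : q 0 = 1) (hq1 : q 1 = Polynomial.X - C (a 0))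
    (hrec : ∀ n, q (n + 2) = (Polynomial.X - C (a (n + 1))) * q (n + 1) - C (b (n + 1)) * q n)
    (hq0' : q' 0 = 1) (hq1' : q' 1 = Polynomial.X - C (a 0)) (hrec' : ∀ n, q' (n + 2) = (Polynomial.X - C (a (n + 1))) * q' (n + 1) - C (b' (n + 1)) * q' n)
    (hb : ∀ j, 0 < b j) (hb' : ∀ j, 0 < b' j) {t : ℕ} (hbb' : ∀ j, 1 ≤ j → j ≤ t → b j ≤ b' j)
    {x y : Fin (t + 1) → ℝ} (hx : StrictMono x) (hxq : q (t + 1) = ∏ j, (Polynomial.X - C (x j))) (hy : StrictMono y) (hyq : q' (t + 1) = ∏ j, (Polynomial.X - C (y j))) :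
    x (Fin.last t) ≤ y (Fin.last t) := by
  rcases t with _ | m
  · -- one zero, `a_0`, for both
    have hx0 : x 0 = a 0 := by
      have hxq1 : q 1 = ∏ j, (Polynomial.X - C (x j)) := hxq
      have h : (q 1).eval (x 0) = 0 := by
        rw [hxq1, eval_prod]; exact Finset.prod_eq_zero (Finset.mem_univ 0) (by rw [eval_sub, eval_X, eval_C, sub_self])
      rw [hq1, eval_sub, eval_X, eval_C] at h
      linarith
    have hy0 : y 0 = a 0 := by
      have hyq1 : q' 1 = ∏ j, (Polynomial.X - C (y j)) := hyq
      have h : (q' 1).eval (y 0) = 0 := by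
        rw [hyq1, eval_prod]; exact Finset.prod_eq_zero (Finset.mem_univ 0) (by rw [eval_sub, eval_X, eval_C, sub_self])
      rw [hq1', eval_sub, eval_X, eval_C] at h
      linarith
    rw [show Fin.last 0 = 0 from rfl, hx0, hy0]
  -- `t = m + 1`
  obtain ⟨μ, hμ, hpair⟩ := favard_pairing_at_zeros hq0 hq1 hrec hb hx hxq
  obtain ⟨μ', hμ', hpair'⟩ := favard_pairing_at_zeros hq0' hq1' hrec' hb' hy hyq
  have hxr : ∀ j, (q (m + 2)).eval (x j) = 0 := fun j => by
    rw [hxq, eval_prod]; exact Finset.prod_eq_zero (Finset.mem_univ j) (by rw [eval_sub, eval_X, eval_C, sub_self])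
  have hyr : ∀ j, (q' (m + 2)).eval (y j) = 0 := fun j => by
    rw [hyq, eval_prod]; exact Finset.prod_eq_zero (Finset.mem_univ j) (by rw [eval_sub, eval_X, eval_C, sub_self])
  -- the norms `h_n = b_1⋯b_n`, `h'_n`
  have hH : ∀ n, 0 < ∏ l ∈ Finset.Ico 1 (n + 1), b l := fun n => Finset.prod_pos fun l _ => hb l
  have hH' : ∀ n, 0 < ∏ l ∈ Finset.Ico 1 (n + 1), b' l := fun n => Finset.prod_pos fun l _ => hb' l
  -- the positive Christoffel–Darboux vector at the top zero, the rescaling, the rescaled vector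
  obtain ⟨v, hv⟩ : ∃ v : Fin (m + 2) → ℝ, v = fun (j : Fin (m + 2)) => (∏ l ∈ Finset.Ico ((j : ℕ) + 1) (m + 2), b l) * (q j).eval (x (Fin.last (m + 1))) := ⟨_, rfl⟩
  have hvpos : ∀ j, 0 < v j := fun j => by
    rw [hv]
    exact mul_pos (Finset.prod_pos fun l _ => hb l) (recurrence_eval_pos_at_top_zero hq0 hq1 hrec hb hx hxq (Nat.lt_succ_iff.1 j.is_lt))
  obtain ⟨s, hs⟩ : ∃ s : Fin (m + 2) → ℝ, s = fun (i : Fin (m + 2)) => Real.sqrt ((∏ l ∈ Finset.Ico 1 ((i : ℕ) + 1), b l) / ∏ l ∈ Finset.Ico 1 ((i : ℕ) + 1), b' l) := ⟨_, rfl⟩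
  have hs2 : ∀ i : Fin (m + 2), (∏ l ∈ Finset.Ico 1 ((i : ℕ) + 1), b' l) * s i ^ 2 = ∏ l ∈ Finset.Ico 1 ((i : ℕ) + 1), b l := fun i => by
    rw [hs]; exact sqrt_rescale_sq (hH i).le (hH' i)
  obtain ⟨u, hu⟩ : ∃ u : Fin (m + 2) → ℝ, u = fun i => v i * s i := ⟨_, rfl⟩
  -- the two polynomials
  obtain ⟨P, hP⟩ : ∃ P : ℝ[X], P = ∑ i : Fin (m + 2), C (v i) * q i := ⟨_, rfl⟩
  obtain ⟨P', hP'⟩ : ∃ P' : ℝ[X], P' = ∑ i : Fin (m + 2), C (u i) * q' i := ⟨_, rfl⟩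
  have hev : ∀ (w : Fin (m + 2) → ℝ) (r : ℕ → ℝ[X]) (z : ℝ), (∑ i : Fin (m + 2), C (w i) * r i).eval z = ∑ i : Fin (m + 2), w i * (r i).eval z := fun w r z => by
    rw [eval_finsetSum]; exact Finset.sum_congr rfl fun i _ => by rw [eval_mul, eval_C]
  -- (A) `P` vanishes at the other zeros, hence `Σ μ x P² = x_t Σ μ P²`
  have hPx : ∀ k, k ≠ Fin.last (m + 1) → P.eval (x k) = 0 := fun k hk => by rw [hP, hv]; exact cd_vector_eval_eq_zero hq0 hq1 hrec hx hxq hk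
  have hFG : ∑ k, μ k * (x k * (P.eval (x k)) ^ 2) = x (Fin.last (m + 1)) * ∑ k, μ k * (P.eval (x k)) ^ 2 := by
    rw [Finset.sum_eq_single (Fin.last (m + 1)) (fun k _ hk => by rw [hPx k hk]; ring) (fun h => absurd (Finset.mem_univ _) h),
      Finset.sum_eq_single (Fin.last (m + 1)) (fun k _ hk => by rw [hPx k hk]; ring) (fun h => absurd (Finset.mem_univ _) h)]
    ring
  -- (B) the Rayleigh bound for the second recurrence
  have hF'le : ∑ k, μ' k * (y k * (P'.eval (y k)) ^ 2) ≤ y (Fin.last (m + 1)) * ∑ k, μ' k * (P'.eval (y k)) ^ 2 :=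
    sum_mul_node_mul_sq_le_last hy (fun k => (hμ' k).le) P'
  -- (C) the norms in coordinates, and their equality
  have hG : ∑ k, μ k * (P.eval (x k)) ^ 2 = ∑ i : Fin (m + 2), (∏ l ∈ Finset.Ico 1 ((i : ℕ) + 1), b l) * v i ^ 2 := by
    rw [hP]; exact favard_norm_sq_combination (h := fun n => ∏ l ∈ Finset.Ico 1 (n + 1), b l) hpair v
  have hG' : ∑ k, μ' k * (P'.eval (y k)) ^ 2 = ∑ i : Fin (m + 2), (∏ l ∈ Finset.Ico 1 ((i : ℕ) + 1), b l) * v i ^ 2 := by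
    rw [hP', favard_norm_sq_combination (h := fun n => ∏ l ∈ Finset.Ico 1 (n + 1), b' l) hpair' u]
    refine Finset.sum_congr rfl fun i _ => ?_
    rw [← hs2 i, hu]
    ring
  have hGpos : 0 < ∑ i : Fin (m + 2), (∏ l ∈ Finset.Ico 1 ((i : ℕ) + 1), b l) * v i ^ 2 :=
    Finset.sum_pos (fun i _ => mul_pos (hH i) (pow_pos (hvpos i) 2)) Finset.univ_nonempty
  -- (D) the `x`-forms compared term by term
  have hFF : ∑ k, μ k * (x k * (P.eval (x k)) ^ 2) ≤ ∑ k, μ' k * (y k * (P'.eval (y k)) ^ 2) := by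
    simp_rw [hP, hP', hev]
    rw [weighted_sq_combination_expand μ x (fun (i : Fin (m + 2)) k => (q i).eval (x k)) v,
      weighted_sq_combination_expand μ' y (fun (i : Fin (m + 2)) k => (q' i).eval (y k)) u]
    refine Finset.sum_le_sum fun i _ => Finset.sum_le_sum fun j _ => ?_
    rw [favard_x_pairing hq0 hq1 hrec hxr hpair i j, favard_x_pairing hq0' hq1' hrec' hyr hpair' i j, mul_add, mul_add, mul_add, mul_add]
    have hvv : 0 < v i * v j := mul_pos (hvpos i) (hvpos j)
    have huu : u i * u j = v i * v j * (s i * s j) := by simp only [hu]; ring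
    refine add_le_add (add_le_add ?_ ?_) ?_
    · -- `j = i + 1`
      by_cases h1 : (i : ℕ) + 1 = j
      · rw [if_pos h1, if_pos h1, huu, mul_assoc (v i * v j) (s i * s j)]
        refine mul_le_mul_of_nonneg_left ?_ hvv.le
        obtain ⟨jj, hjj⟩ := j
        dsimp only at h1 ⊢
        subst h1
        have := sqrt_rescale_cross_ge hb hb' (hbb' ((i : ℕ) + 1) (by omega) (by omega))
        simpa only [hs, mul_comm, mul_left_comm, mul_assoc] using this
      · rw [if_neg h1, if_neg h1, mul_zero, mul_zero]
    · -- `i = j`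
      by_cases h2 : (i : ℕ) = j
      · have hij : i = j := Fin.ext h2
        subst hij
        rw [if_pos rfl, if_pos rfl, huu]
        have : v i * v i * (s i * s i) * (a i * ∏ l ∈ Finset.Ico 1 ((i : ℕ) + 1), b' l) = v i * v i * (a i * ((∏ l ∈ Finset.Ico 1 ((i : ℕ) + 1), b' l) * s i ^ 2)) := by ring
        rw [this, hs2 i]
      · rw [if_neg h2, if_neg h2, mul_zero, mul_zero]
    · -- `i = j + 1`
      by_cases h3 : (i : ℕ) = j + 1
      · rw [if_pos h3, if_pos h3, huu, mul_assoc (v i * v j) (s i * s j)]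
        refine mul_le_mul_of_nonneg_left ?_ hvv.le
        obtain ⟨ii, hii⟩ := i
        dsimp only at h3 ⊢
        subst h3
        have := sqrt_rescale_cross_ge hb hb' (hbb' ((j : ℕ) + 1) (by omega) (by omega))
        simpa only [hs, mul_comm, mul_left_comm, mul_assoc] using this
      · rw [if_neg h3, if_neg h3, mul_zero, mul_zero]
  -- the chain `x_t G = F ≤ F' ≤ y_t G`
  rw [hG] at hFG
  rw [hG'] at hF'le
  exact le_of_mul_le_mul_right (by rw [← hFG]; exact hFF.trans hF'le) hGpos

/-- **THE SMALLEST ZERO IS NON-INCREASING IN THE OFF-DIAGONAL COEFFICIENTS: same `a`, `0 < b_j ≤ b'_j` for `1 ≤ j ≤ t` ⇒ `x'_0 ≤ x_0`** (the reflection `a ↦ −a` turns bottom zeros into top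
zeros). [Perron 1907; Ismail Thm 7.4.1; this file, §1090] -/
theorem bottom_zero_anti_offdiag {q q' : ℕ → ℝ[X]} {a b b' : ℕ → ℝ} (hq0 : q 0 = 1) (hq1 : q 1 = Polynomial.X - C (a 0))
    (hrec : ∀ n, q (n + 2) = (Polynomial.X - C (a (n + 1))) * q (n + 1) - C (b (n + 1)) * q n)
    (hq0' : q' 0 = 1) (hq1' : q' 1 = Polynomial.X - C (a 0)) (hrec' : ∀ n, q' (n + 2) = (Polynomial.X - C (a (n + 1))) * q' (n + 1) - C (b' (n + 1)) * q' n)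
    (hb : ∀ j, 0 < b j) (hb' : ∀ j, 0 < b' j) {t : ℕ} (hbb' : ∀ j, 1 ≤ j → j ≤ t → b j ≤ b' j)
    {x y : Fin (t + 1) → ℝ} (hx : StrictMono x) (hxq : q (t + 1) = ∏ j, (Polynomial.X - C (x j))) (hy : StrictMono y) (hyq : q' (t + 1) = ∏ j, (Polynomial.X - C (y j))) :
    y 0 ≤ x 0 := by
  obtain ⟨h0, h1, h2, h3⟩ := recurrence_reflect_spec hq0 hq1 hrec
  obtain ⟨h0', h1', h2', h3'⟩ := recurrence_reflect_spec hq0' hq1' hrec'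
  have h := top_zero_mono_offdiag (q := fun n => C ((-1 : ℝ) ^ n) * (q n).comp (C (-1 : ℝ)⁻¹ * Polynomial.X))
    (q' := fun n => C ((-1 : ℝ) ^ n) * (q' n).comp (C (-1 : ℝ)⁻¹ * Polynomial.X)) (a := fun n => -a n)
    h0 h1 h2 h0' h1' h2' hb hb' hbb' (strictMono_neg_comp_rev hx) (h3 hxq) (strictMono_neg_comp_rev hy) (h3' hyq)
  simp only [Fin.rev_last] at h
  linarith

end Summit.Ventures.HSemireg.Wedge.HankelOuter
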